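import Mathlib
import HarnessLib
import Literature.MathematicalPhysics.StatisticalMechanics.WeightedNormDominationSection
import Literature.MathematicalPhysics.StatisticalMechanics.WeightTowerStrong
import Literature.MathematicalPhysics.QuantumFieldTheory.GaussianQuadraticIntegrable

/-!
# Quadratic weights are dominated along the lift section under a subcritical Gaussian
# (Adams–Buchholz–Kotecký–Müller, Lemma 8.4 for the weights `e^{½(φ,A_k^Xφ)}` of Ch. 7)

For the weights `w(φ) = e^{½(φ, Aφ)}` (`A ⪰ 0` symmetric; `w_k^X`, `w_{k:k+1}^X` of [ABKM19] Ch. 7)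
and the fluctuation measure `μ = N(0, C)` pushed to field space, the hypothesis
`WeightSectionDominated T w μ` of `TayNormLE.integral_comp_add_section` holds for EVERY gauge `T`
as soon as `(1+η)A` is still subcritical for `C` for some `η > 0` (for the tower:
`√C A √C ⪯ θ·1` with `θ < 1`, Lemma 7.7): on a gauge ball the section fields `σ(v)` are bounded,
and `((σv + ξ), A(σv + ξ)) ≤ (1 + η⁻¹)(σv, Aσv) + (1 + η)(ξ, Aξ)`, so
`H(ξ) = K · e^{½(1+η)(ξ,Aξ)}` dominates, integrable by `GaussianQuadraticIntegrable`.

* `quadForm_add_le` (the Young-type inequality for `A ⪰ 0`), `abs_quadForm_le` (`|(φ,Aφ)| ≤ (Σ|A_ij|)‖φ‖²_∞`);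
* **`weightSectionDominated_expWeight`**.

Everything is proved; no named fact.

## References
* S. Adams, S. Buchholz, R. Kotecký, S. Müller, arXiv:1910.13564, Lemma 8.4, Lemma 7.7
  [AdamsBuchholzKoteckyMuller2019].
-/

noncomputable section

namespace Literature.MathematicalPhysics.StatisticalMechanics.GradientRG

open MeasureTheory ProbabilityTheory WithLp Matrix Finset Metric
open scoped MatrixOrder
open Literature.MathematicalPhysics.QuantumFieldTheory

variable {Λ : Type*} [Fintype Λ] [DecidableEq Λ]

omit [DecidableEq Λ] in
/-- **Young-type inequality for a non-negative form**: `((x+y), A(x+y)) ≤ (1+η⁻¹)(x,Ax) + (1+η)(y,Ay)`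
for `A ⪰ 0`, `η > 0`. [cite: AdamsBuchholzKoteckyMuller2019, Lemma 8.4 (proof)] -/
theorem quadForm_add_le {A : Matrix Λ Λ ℝ} (hA : A.PosSemidef) {η : ℝ} (hη : 0 < η) (x y : Λ → ℝ) :
    (x + y) ⬝ᵥ A *ᵥ (x + y) ≤ (1 + η⁻¹) * (x ⬝ᵥ A *ᵥ x) + (1 + η) * (y ⬝ᵥ A *ᵥ y) := by
  have hAT : Aᵀ = A := by
    have h := hA.1
    rw [Matrix.IsHermitian, Matrix.conjTranspose_eq_transpose_of_trivial] at h
    exact h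
  have hsym : ∀ a b : Λ → ℝ, a ⬝ᵥ A *ᵥ b = b ⬝ᵥ A *ᵥ a := fun a b => by
    rw [Matrix.dotProduct_mulVec a A b, ← Matrix.mulVec_transpose, hAT, dotProduct_comm]
  have h0 := hA.dotProduct_mulVec_nonneg (η • y - x)
  rw [star_trivial] at h0
  have h0' : 0 ≤ η * (η * (y ⬝ᵥ A *ᵥ y)) - η * (y ⬝ᵥ A *ᵥ x) - (η * (y ⬝ᵥ A *ᵥ x) - x ⬝ᵥ A *ᵥ x) := by
    have := h0
    simp only [Matrix.mulVec_sub, Matrix.mulVec_smul, sub_dotProduct, dotProduct_sub, smul_dotProduct,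
      dotProduct_smul, smul_eq_mul, hsym x y] at this
    linarith
  rw [Matrix.mulVec_add, add_dotProduct, dotProduct_add, dotProduct_add, hsym x y]
  -- `2(y,Ax) ≤ η(y,Ay) + η⁻¹(x,Ax)`
  have hcross : 2 * (y ⬝ᵥ A *ᵥ x) ≤ η * (y ⬝ᵥ A *ᵥ y) + η⁻¹ * (x ⬝ᵥ A *ᵥ x) := by
    have h2 : η * (2 * (y ⬝ᵥ A *ᵥ x)) ≤ η * (η * (y ⬝ᵥ A *ᵥ y) + η⁻¹ * (x ⬝ᵥ A *ᵥ x)) := by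
      rw [mul_add, ← mul_assoc η η⁻¹, mul_inv_cancel₀ hη.ne', one_mul]; linarith
    exact le_of_mul_le_mul_left h2 hη
  nlinarith [hcross]

omit [DecidableEq Λ] in
/-- `|(φ, Aφ)| ≤ (Σ_{ij}|A_ij|)·‖φ‖²` in the sup norm. [cite: AdamsBuchholzKoteckyMuller2019, Lemma 8.4 (proof)] -/
theorem abs_quadForm_le (A : Matrix Λ Λ ℝ) (φ : Λ → ℝ) :
    |φ ⬝ᵥ A *ᵥ φ| ≤ (∑ i, ∑ j, |A i j|) * ‖φ‖ ^ 2 := by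
  have hφ : ∀ i, |φ i| ≤ ‖φ‖ := fun i => by rw [← Real.norm_eq_abs]; exact norm_le_pi_norm φ i
  have hrow : ∀ i, |φ i * (A *ᵥ φ) i| ≤ (∑ j, |A i j|) * ‖φ‖ ^ 2 := by
    intro i
    have hmv : (A *ᵥ φ) i = ∑ j, A i j * φ j := rfl
    rw [hmv, abs_mul, Finset.sum_mul]
    calc |φ i| * |∑ j, A i j * φ j| ≤ ‖φ‖ * ∑ j, |A i j| * ‖φ‖ := by
          refine mul_le_mul (hφ i) ((Finset.abs_sum_le_sum_abs _ _).trans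
            (Finset.sum_le_sum fun j _ => ?_)) (abs_nonneg _) (norm_nonneg _)
          rw [abs_mul]
          exact mul_le_mul_of_nonneg_left (hφ j) (abs_nonneg _)
      _ = ∑ j, |A i j| * ‖φ‖ ^ 2 := by rw [Finset.mul_sum]; exact Finset.sum_congr rfl fun j _ => by ring
  rw [dotProduct, Finset.sum_mul]
  exact (Finset.abs_sum_le_sum_abs _ _).trans (Finset.sum_le_sum fun i _ => hrow i)

/-- **Section domination of the quadratic weights under a subcritical Gaussian** (hypothesis of
`TayNormLE.integral_comp_add_section` for [ABKM19]'s `w_k^X`): for `A ⪰ 0`, `η > 0` with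
`1 − √C((1+η)A)√C ≻ 0`, every gauge `T` on field space, and `μ = N(0,C)` pushed forward to
`Λ → ℝ`: `WeightSectionDominated T (e^{½(·,A·)}) μ`. [cite: AdamsBuchholzKoteckyMuller2019, Lemma 8.4] -/
theorem weightSectionDominated_expWeight {V : Type*} [NormedAddCommGroup V] [NormedSpace ℝ V]
    (T : (Λ → ℝ) →ₗ[ℝ] V) {A C : Matrix Λ Λ ℝ} (hA : A.PosSemidef) {η : ℝ} (hη : 0 < η)
    (hCA : ((1 : Matrix Λ Λ ℝ) - CFC.sqrt C * ((1 + η) • A) * CFC.sqrt C).PosDef) :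
    WeightSectionDominated T (expWeight A)
      ((multivariateGaussian 0 C).map (ofLp : EuclideanSpace ℝ Λ → Λ → ℝ)) := by
  intro v₀
  set σ := LinearMap.toContinuousLinearMap (gaugeSection T) with hσ
  set a : ℝ := ∑ i, ∑ j, |A i j| with ha
  set B : ℝ := a * (‖σ‖ * (‖v₀‖ + 1)) ^ 2 with hB
  set H : (Λ → ℝ) → ℝ := fun ξ =>
    Real.exp ((1/2 : ℝ) * (1 + η⁻¹) * B) * Real.exp ((1/2 : ℝ) * ((1 + η) * (ξ ⬝ᵥ A *ᵥ ξ))) with hH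
  refine ⟨1, one_pos, H, ?_, fun ξ v hv => ?_⟩
  · -- integrability: pull back to `N(0,C)` and use the subcriticality of `(1+η)A`
    have hcont : Continuous H := by
      refine continuous_const.mul (Real.continuous_exp.comp (continuous_const.mul
        (continuous_const.mul (continuous_id.dotProduct (continuous_const.matrix_mulVec continuous_id)))))
    rw [integrable_map_measure hcont.aestronglyMeasurable (PiLp.continuous_ofLp 2 _).measurable.aemeasurable]
    have hA' : ((1 + η) • A).IsSymm := by
      have h := hA.1
      rw [Matrix.IsHermitian, Matrix.conjTranspose_eq_transpose_of_trivial] at h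
      exact Matrix.IsSymm.smul h _
    have hint := (integrable_exp_half_quadForm_shift_multivariateGaussian C hA' hCA 0).const_mul
      (Real.exp ((1/2 : ℝ) * (1 + η⁻¹) * B))
    refine hint.congr (ae_of_all _ fun ψ => ?_)
    simp only [Function.comp_apply, hH, zero_add, Matrix.smul_mulVec, dotProduct_smul, smul_eq_mul]
  · -- pointwise bound on the gauge ball of radius `1`
    have hvn : ‖v‖ ≤ ‖v₀‖ + 1 := by
      have := norm_sub_norm_le v v₀; linarith
    have hσv : ‖gaugeSection T v‖ ≤ ‖σ‖ * (‖v₀‖ + 1) := by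
      have h1 : ‖σ v‖ ≤ ‖σ‖ * ‖v‖ := σ.le_opNorm v
      have h2 : (σ v : Λ → ℝ) = gaugeSection T v := rfl
      rw [← h2]
      exact h1.trans (mul_le_mul_of_nonneg_left hvn (norm_nonneg σ))
    have hquad : gaugeSection T v ⬝ᵥ A *ᵥ gaugeSection T v ≤ B := by
      refine (le_abs_self _).trans ((abs_quadForm_le A _).trans ?_)
      rw [hB]
      exact mul_le_mul_of_nonneg_left (pow_le_pow_left₀ (norm_nonneg _) hσv 2)
        (Finset.sum_nonneg fun _ _ => Finset.sum_nonneg fun _ _ => abs_nonneg _)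
    rw [expWeight, hH]
    simp only
    rw [← Real.exp_add]
    refine Real.exp_le_exp.2 ?_
    have h1 := quadForm_add_le hA hη (gaugeSection T v) ξ
    have hη' : 0 ≤ 1 + η⁻¹ := by positivity
    nlinarith [mul_le_mul_of_nonneg_left hquad hη']

end Literature.MathematicalPhysics.StatisticalMechanics.GradientRG

end
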